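import Literature.AnabelianGeometry.AbsoluteAnabelian.MonoidKummerModelNaturality
import Literature.AnabelianGeometry.AbsoluteAnabelian.MonoidKummerTransport
import Literature.AnabelianGeometry.EtaleTheta.KummerFunctorialityCovariantIso

/-!
# [AbsTopIII] Prop 3.2 (ii) on ABSTRACT MLF-Galois `TM`-pairs: naturality along morphisms of pairs and
# canonicity of the transported Kummer theory (independence of the model presentation)

S. Mochizuki, *Topics in absolute anabelian geometry III*, §3, Prop. 3.2 (ii) p. 71 (bib key
`MochizukiAbsTopIII2015`; locators = kurims manuscript pages, lit key `paper:url-5493eb38cbb7`): the Kummer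
maps `M^H_TM → H¹(H, μ_Ẑ(M_TM))` of an MLF-Galois `TM`-pair `(Π ↷ M_TM)` are obtained by "a functorial
algorithm", functorial relative to `𝒞^MLF_TM` (preamble p. 71 l. 15–17; morphisms = Def. 3.1 (ii) p. 67).

State of the tree (seat abc-iut-L4-t2): `MonoidKummerModel.lean` constructs the Kummer theory of a MODEL
pair `(Π_k ↷ 𝒪_k̄^⊳)`; `MonoidKummerTransport.lean` transports it along an isomorphism
`e : (Π_k ↷ 𝒪_k̄^⊳) ⥲ P` to an abstract MLF-Galois `TM`-pair `P` and proves EXISTENCE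
(`exists_monoidKummerTheory_recoversClosure`) — a `∃`-packaging over a CHOSEN model presentation;
`MonoidKummerModelNaturality.lean` proves naturality of the model Kummer maps along arbitrary equivariant
pairs `(φ_Π, φ_M)` between model pairs.  This file closes the two clauses the layer registry records as
open for abstract pairs (abc-iut-L4-lead RULINGS #5f (3), #5p (1)(2): «canonicity of the ∃-packaging for
ABSTRACT pairs», «naturality along general morphisms»):

* `GaloisMonoidPair.ModelPresentation P` — the data `(k, k̄, Π_k ↠ G_k, e : (Π_k ↷ 𝒪_k̄^⊳) ⥲ P)`
  witnessing `P ∈ 𝒞^MLF_TM` (inhabited iff `IsMLFGaloisMonoidPair .TM P`, `nonempty_iff`), and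
  `ModelPresentation.kummerTheory π := (kummerTheory of the model).transport e` — the Kummer theory of
  `MonoidKummerTransport.lean`, now as a function of the presentation;
* **naturality on abstract pairs** `ModelPresentation.kummer_natural`: for a morphism
  `f : (Π ↷ M) → (Π' ↷ M')` of Def. 3.1 (ii) between abstract pairs with presentations `π`, `π'`, open
  `H ⊆ Π`, `H' ⊆ Π'` with `f_Π(H) ⊆ H'` and `m ∈ M^H` with `f_M(m) ∈ M'^{H'}`, the Kummer classes of
  `π.kummerTheory` / `π'.kummerTheory` satisfy `pull (κ_{H'}(f_M m)) = push (κ_H(m))` along the transition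
  pair `(e'⁻¹ f_Π e, e'⁻¹ f_M e)` of the models (carriers: the genuine `H¹(e⁻¹H, Λ(k̄ˣ))`);
* **canonicity** `ModelPresentation.canonicalEquiv π₁ π₂ H : (π₁.kummerTheory).H¹(H) ≃+ (π₂.kummerTheory).H¹(H)`
  for two presentations of the SAME pair — the comparison isomorphism of the transition ISOMORPHISM
  `e₂⁻¹ e₁` of models (`EtaleTheta.EquivariantMorphism.comparisonIso`: both legs of the cospan invertible) —
  with **`canonicalEquiv_kummer : canonicalEquiv (κ₁_H(m)) = κ₂_H(m)`**: the Kummer maps of the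
  `∃`-packaged theory do not depend on the chosen model, up to this canonical identification of carriers.

Also: functoriality of `unitsLift` (`unitsLift_comp`, `unitsLift_id`, `unitsLiftEquiv`).  Mathlib's
`groupCohomology` is single-universe, so everything cohomological is at universe `0`.  HONEST FRAMING:
classical Kummer theory; the Kummer theories are still OBTAINED from models (the group-theoretic
reconstruction of the field structure, Prop. 3.2 (iii) via Cor. 1.10 (h), is campaign-L input and untouched);
nothing here bears on [IUTchIII] Cor. 3.12; no side taken.
-/

noncomputable section

namespace Literature.AnabelianGeometry.AbsoluteAnabelian

open _root_.CategoryTheory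
open Literature.AnabelianGeometry.EtaleTheta (kummerClass invariants cyclotomeRep EquivariantMorphism)

universe u

/-! ### Functoriality of `unitsLift` -/

namespace ModelMLFGaloisData

variable {C₁ C₂ C₃ : MLFClosure.{u}}

/-- `unitsLift` is functorial: `unitsLift (χ ∘ ψ) = unitsLift χ ∘ unitsLift ψ`.
[cite: MochizukiAbsTopIII2015, Definition 3.1 (iii) p.68] -/
theorem unitsLift_comp (ψ : nonzeroIntegers C₁.k C₁.K →* nonzeroIntegers C₂.k C₂.K)
    (χ : nonzeroIntegers C₂.k C₂.K →* nonzeroIntegers C₃.k C₃.K) :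
    unitsLift (χ.comp ψ) = (unitsLift χ).comp (unitsLift ψ) :=
  (unitsLift_unique (χ.comp ψ) _ fun m => by
    rw [MonoidHom.comp_apply, unitsLift_toUnit, unitsLift_toUnit, MonoidHom.comp_apply]).symm

/-- `unitsLift id = id`. [cite: MochizukiAbsTopIII2015, Definition 3.1 (iii) p.68] -/
theorem unitsLift_id : unitsLift (MonoidHom.id (nonzeroIntegers C₁.k C₁.K)) = MonoidHom.id (C₁.K)ˣ :=
  (unitsLift_unique (MonoidHom.id _) _ fun _ => rfl).symm

/-- `unitsLift` of an ISOMORPHISM `𝒪_k̄₁^⊳ ≃ 𝒪_k̄₂^⊳` is an isomorphism `k̄₁ˣ ≃ k̄₂ˣ` (inverse: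
`unitsLift` of the inverse). [cite: MochizukiAbsTopIII2015, Definition 3.1 (iii) p.68] -/
def unitsLiftEquiv (e : nonzeroIntegers C₁.k C₁.K ≃* nonzeroIntegers C₂.k C₂.K) : (C₁.K)ˣ ≃* (C₂.K)ˣ :=
  MonoidHom.toMulEquiv (unitsLift e.toMonoidHom) (unitsLift e.symm.toMonoidHom)
    (by
      rw [← unitsLift_comp]
      convert unitsLift_id (C₁ := C₁) using 2
      exact MonoidHom.ext fun m => e.symm_apply_apply m)
    (by
      rw [← unitsLift_comp]
      convert unitsLift_id (C₁ := C₂) using 2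
      exact MonoidHom.ext fun m => e.apply_symm_apply m)

/-- `unitsLiftEquiv e` is `unitsLift e` on elements. [cite: MochizukiAbsTopIII2015, Definition 3.1 (iii) p.68] -/
@[simp] theorem unitsLiftEquiv_apply (e : nonzeroIntegers C₁.k C₁.K ≃* nonzeroIntegers C₂.k C₂.K)
    (u : (C₁.K)ˣ) : unitsLiftEquiv e u = unitsLift e.toMonoidHom u := rfl

/-- Hence `unitsLift` of an isomorphism is bijective. [cite: MochizukiAbsTopIII2015, Definition 3.1 (iii) p.68] -/
theorem unitsLift_bijective (e : nonzeroIntegers C₁.k C₁.K ≃* nonzeroIntegers C₂.k C₂.K) :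
    Function.Bijective (unitsLift e.toMonoidHom) :=
  (unitsLiftEquiv e).bijective

end ModelMLFGaloisData

/-! ### Model presentations of an abstract pair and their Kummer theories -/

namespace GaloisMonoidPair

/-- A **model presentation** of an abstract pair `P = (Π ↷ M)`: model data `(k, k̄, ε_k : Π_k ↠ G_k)`
(Def. 3.1 (i)) together with an isomorphism of pairs `e : (Π_k ↷ 𝒪_k̄^⊳) ⥲ (Π ↷ M)` (Def. 3.1 (ii)) — the
witness that `P` is an MLF-Galois `TM`-pair ("isomorphic to the model object …").
[cite: MochizukiAbsTopIII2015, Definition 3.1 (ii) p.67] -/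
structure ModelPresentation (P : GaloisMonoidPair.{u}) : Type (u + 1) where
  /-- the MLF `k` with an algebraic closure `k̄` -/
  C : MLFClosure.{u}
  /-- the model data `ε_k : Π_k ↠ G_k` -/
  D : ModelMLFGaloisData C.k C.K
  /-- the isomorphism of pairs `(Π_k ↷ 𝒪_k̄^⊳) ⥲ P` -/
  iso : GaloisMonoidPair.Iso D.tmPair P

namespace ModelPresentation

section General

variable {P Q : GaloisMonoidPair.{u}}

/-- A pair admits a model presentation iff it is an MLF-Galois `TM`-pair (Def. 3.1 (ii)).
[cite: MochizukiAbsTopIII2015, Definition 3.1 (ii) p.67] -/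
theorem nonempty_iff : Nonempty P.ModelPresentation ↔ IsMLFGaloisMonoidPair .TM P := by
  constructor
  · rintro ⟨π⟩
    exact ⟨⟨π.C, π.D, π.D.tmPair, π.D.monoidPair_TM, ⟨π.iso⟩⟩⟩
  · intro hP
    obtain ⟨C, D, Q₀, hQ₀, ⟨e⟩⟩ := hP.exists_model
    have hQ' : D.tmPair = Q₀ := Option.some_injective _ (D.monoidPair_TM.symm.trans hQ₀)
    subst hQ'
    exact ⟨⟨C, D, e⟩⟩

/-- The open subgroup `e⁻¹(H) ⊆ Π_k` of the model corresponding to an open `H ⊆ Π` under a presentation.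
[cite: MochizukiAbsTopIII2015, Definition 3.1 (ii) p.67] -/
abbrev comapOpen (π : P.ModelPresentation) (H : OpenSubgroup P.Pi) : OpenSubgroup π.D.tmPair.Pi :=
  H.comap π.iso.isoPi.toMonoidHom π.iso.isoPi.continuous

end General

section KummerTheory

variable {P : GaloisMonoidPair.{0}}

/-- **The Kummer theory of a presentation**: the model Kummer theory (`ModelMLFGaloisData.kummerTheory`,
Prop. 3.2 (ii)(iii)) transported along `e` (`MonoidKummerTheory.transport`) — the theory packaged
existentially in `exists_monoidKummerTheory_recoversClosure`.  Its `H¹(H)` IS the genuine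
`H¹(e⁻¹H, Λ(k̄ˣ))` (Mathlib `groupCohomology.H1`). [cite: MochizukiAbsTopIII2015, Proposition 3.2 (ii) p.71] -/
def kummerTheory (π : P.ModelPresentation) : MonoidKummerTheory P :=
  (π.D.kummerTheory π.C).transport π.iso

/-- The Kummer theory of a presentation recovers the closure `k̄ ⊇ 𝒪_k̄^⊳` (Prop. 3.2 (v), objects) through
`m ↦ e⁻¹(m) ∈ 𝒪_k̄^⊳ ⊆ k̄`. [cite: MochizukiAbsTopIII2015, Proposition 3.2 (v) p.72] -/
theorem kummerTheory_recoversClosure (π : P.ModelPresentation) :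
    π.kummerTheory.RecoversClosure π.C (fun m => ((π.iso.isoM.symm m : π.D.tmPair.M) : π.C.K)) :=
  (π.D.kummerTheory_recoversClosure π.C).transport π.iso

/-- The Kummer map of `π.kummerTheory` at `H`, unfolded: the model Kummer class at `e⁻¹H` of `e⁻¹m`.
[cite: MochizukiAbsTopIII2015, Proposition 3.2 (ii) p.71] -/
theorem kummerTheory_kummer (π : P.ModelPresentation) (H : OpenSubgroup P.Pi)
    (m : {m : P.M // ∀ h : H, (h : P.Pi) • m = m}) :
    π.kummerTheory.kummer H m = (π.D.kummerTheory π.C).kummer (π.comapOpen H)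
      ⟨π.iso.isoM.symm m.1, fun g => π.iso.smul_symm_eq_of_mem_comap m.2 g⟩ :=
  rfl

end KummerTheory

/-! ### The transition pair of a morphism between presented pairs -/

section Transition

variable {P Q : GaloisMonoidPair.{u}} (f : GaloisMonoidPair.Hom P Q) (π : P.ModelPresentation) (ϖ : Q.ModelPresentation)

/-- The transition homomorphism `e'⁻¹ ∘ f_Π ∘ e : Π_k → Π_{k'}` of a morphism of presented pairs.
[cite: MochizukiAbsTopIII2015, Definition 3.1 (ii) p.67] -/
def transitionPi : π.D.Pi →* ϖ.D.Pi :=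
  (ϖ.iso.isoPi.symm.toMonoidHom.comp f.homPi).comp π.iso.isoPi.toMonoidHom

/-- The transition homomorphism `e'⁻¹ ∘ f_M ∘ e : 𝒪_k̄^⊳ → 𝒪_k̄'^⊳` of a morphism of presented pairs.
[cite: MochizukiAbsTopIII2015, Definition 3.1 (ii) p.67] -/
def transitionM : nonzeroIntegers π.C.k π.C.K →* nonzeroIntegers ϖ.C.k ϖ.C.K :=
  (ϖ.iso.isoM.symm.toMonoidHom.comp f.homM).comp π.iso.isoM.toMonoidHom

/-- `transitionPi` on elements. [cite: MochizukiAbsTopIII2015, Definition 3.1 (ii) p.67] -/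
@[simp] theorem transitionPi_apply (g : π.D.Pi) :
    transitionPi f π ϖ g = ϖ.iso.isoPi.symm (f.homPi (π.iso.isoPi g)) := rfl

/-- `transitionM` on elements. [cite: MochizukiAbsTopIII2015, Definition 3.1 (ii) p.67] -/
@[simp] theorem transitionM_apply (m : nonzeroIntegers π.C.k π.C.K) :
    transitionM f π ϖ m = ϖ.iso.isoM.symm (f.homM (π.iso.isoM m)) := rfl

/-- The transition pair is equivariant. [cite: MochizukiAbsTopIII2015, Definition 3.1 (ii) p.67] -/
theorem transition_smul (g : π.D.Pi) (m : nonzeroIntegers π.C.k π.C.K) :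
    transitionM f π ϖ (g • m) = transitionPi f π ϖ g • transitionM f π ϖ m := by
  change ϖ.iso.symm.isoM (f.homM (π.iso.isoM (g • m))) =
    ϖ.iso.symm.isoPi (f.homPi (π.iso.isoPi g)) • ϖ.iso.symm.isoM (f.homM (π.iso.isoM m))
  rw [π.iso.smul_comm, f.smul_comm, ϖ.iso.symm.smul_comm]

/-- `f_Π(H) ⊆ H'` implies `(e'⁻¹ f_Π e)(e⁻¹H) ⊆ e'⁻¹H'`. [cite: MochizukiAbsTopIII2015, Definition 3.1 (ii) p.67] -/
theorem map_transitionPi_le {H : OpenSubgroup P.Pi} {H' : OpenSubgroup Q.Pi}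
    (hH : (H : Subgroup P.Pi).map f.homPi ≤ (H' : Subgroup Q.Pi)) :
    ((π.comapOpen H : OpenSubgroup π.D.tmPair.Pi) : Subgroup π.D.Pi).map (transitionPi f π ϖ) ≤
      ((ϖ.comapOpen H' : OpenSubgroup ϖ.D.tmPair.Pi) : Subgroup ϖ.D.Pi) := by
  rintro _ ⟨x, hx, rfl⟩
  change ϖ.iso.isoPi (ϖ.iso.isoPi.symm (f.homPi (π.iso.isoPi x))) ∈ (H' : Subgroup Q.Pi)
  rw [ContinuousMulEquiv.apply_symm_apply]
  exact hH ⟨π.iso.isoPi x, hx, rfl⟩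

end Transition

/-! ### Naturality of the Kummer maps on abstract pairs -/

section Natural

variable {P Q : GaloisMonoidPair.{0}} (f : GaloisMonoidPair.Hom P Q)
  (π : P.ModelPresentation) (ϖ : Q.ModelPresentation)

/-- The equivariant morphism of units `(Π_k ↷ k̄ˣ) → (Π_{k'} ↷ k̄'ˣ)` underlying the transition pair of `f`.
[cite: MochizukiAbsTopIII2015, Definition 3.1 (ii) p.67] -/
abbrev transitionMorphism : EquivariantMorphism π.D.Pi (π.C.K)ˣ ϖ.D.Pi (ϖ.C.K)ˣ :=
  ModelMLFGaloisData.unitsMorphism (transitionM f π ϖ) (transitionPi f π ϖ) (transition_smul f π ϖ)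

/-- **[AbsTopIII] Prop 3.2 (ii) — naturality of the Kummer maps along a morphism of ABSTRACT MLF-Galois
`TM`-pairs.**  Let `f = (f_Π, f_M) : (Π ↷ M) → (Π' ↷ M')` be a morphism of pairs (Def. 3.1 (ii)) with model
presentations `π = (k, e)`, `π' = (k', e')`, let `H ⊆ Π`, `H' ⊆ Π'` be open with `f_Π(H) ⊆ H'`, and
`m ∈ M^H` with `f_M(m) ∈ M'^{H'}`.  Then, in `H¹(e⁻¹H, res Λ(k̄'ˣ))`,
`pull (κ'_{H'}(f_M m)) = push (κ_H(m))` for the Kummer maps `κ = π.kummerTheory.kummer`,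
`κ' = π'.kummerTheory.kummer` (carriers `H¹(e⁻¹H, Λ(k̄ˣ))`, `H¹(e'⁻¹H', Λ(k̄'ˣ))`), pull/push being taken along
the transition pair `(e'⁻¹ f_Π e, e'⁻¹ f_M e)` ("a functorial algorithm for constructing … the Kummer maps").
[cite: MochizukiAbsTopIII2015, Proposition 3.2 (ii) p.71] -/
theorem kummer_natural (H : OpenSubgroup P.Pi) (H' : OpenSubgroup Q.Pi)
    (hH : (H : Subgroup P.Pi).map f.homPi ≤ (H' : Subgroup Q.Pi))
    (m : {m : P.M // ∀ h : H, (h : P.Pi) • m = m})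
    (hm : ∀ h : H', (h : Q.Pi) • f.homM m.1 = f.homM m.1) :
    (transitionMorphism f π ϖ).pullH1 (map_transitionPi_le f π ϖ hH)
        (ϖ.kummerTheory.kummer H' ⟨f.homM m.1, hm⟩) =
      (transitionMorphism f π ϖ).pushH1 (map_transitionPi_le f π ϖ hH) (π.kummerTheory.kummer H m) := by
  -- the element `e'⁻¹(f_M m)` of the second model, with its `e'⁻¹H'`-invariance, IS `φ_M(e⁻¹ m)`
  have hm₂ : ∀ h : ϖ.comapOpen H',
      (h : ϖ.D.tmPair.Pi) • transitionM f π ϖ (π.iso.isoM.symm m.1) =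
        transitionM f π ϖ (π.iso.isoM.symm m.1) := by
    intro h
    rw [transitionM_apply, MulEquiv.apply_symm_apply]
    exact ϖ.iso.smul_symm_eq_of_mem_comap hm h
  have key : (⟨ϖ.iso.isoM.symm (f.homM m.1), fun g => ϖ.iso.smul_symm_eq_of_mem_comap hm g⟩ :
        {x : ϖ.D.tmPair.M // ∀ h : ϖ.comapOpen H', (h : ϖ.D.tmPair.Pi) • x = x}) =
      ⟨transitionM f π ϖ (π.iso.isoM.symm m.1), hm₂⟩ :=
    Subtype.ext (by
      change ϖ.iso.isoM.symm (f.homM m.1) = transitionM f π ϖ (π.iso.isoM.symm m.1)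
      rw [transitionM_apply, MulEquiv.apply_symm_apply])
  have nat := ModelMLFGaloisData.kummer_natural (transitionPi f π ϖ) (transitionM f π ϖ)
    (transition_smul f π ϖ) (π.comapOpen H) (ϖ.comapOpen H') (map_transitionPi_le f π ϖ hH)
    ⟨π.iso.isoM.symm m.1, fun g => π.iso.smul_symm_eq_of_mem_comap m.2 g⟩ hm₂
  rw [kummerTheory_kummer, kummerTheory_kummer]
  exact (congrArg (fun x => (transitionMorphism f π ϖ).pullH1 (map_transitionPi_le f π ϖ hH)
    ((ϖ.D.kummerTheory ϖ.C).kummer (ϖ.comapOpen H') x)) key).trans nat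

end Natural

/-! ### Canonicity: two presentations of the same pair -/

section Canonical

variable {P : GaloisMonoidPair.{u}} (π₁ π₂ : P.ModelPresentation)

/-- The **change-of-presentation isomorphism** `e₂⁻¹ ∘ e₁ : (Π_{k₁} ↷ 𝒪_k̄₁^⊳) ⥲ (Π_{k₂} ↷ 𝒪_k̄₂^⊳)` between
the two models. [cite: MochizukiAbsTopIII2015, Definition 3.1 (ii) p.67] -/
def changeIso : GaloisMonoidPair.Iso π₁.D.tmPair π₂.D.tmPair := π₁.iso.trans π₂.iso.symm

/-- `changeIso` on the groups: `g ↦ e₂⁻¹(e₁ g)`. [cite: MochizukiAbsTopIII2015, Definition 3.1 (ii) p.67] -/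
@[simp] theorem changeIso_isoPi_apply (g : π₁.D.Pi) :
    (changeIso π₁ π₂).isoPi g = π₂.iso.isoPi.symm (π₁.iso.isoPi g) := rfl

/-- `changeIso` on the monoids: `m ↦ e₂⁻¹(e₁ m)`. [cite: MochizukiAbsTopIII2015, Definition 3.1 (ii) p.67] -/
@[simp] theorem changeIso_isoM_apply (m : π₁.D.tmPair.M) :
    (changeIso π₁ π₂).isoM m = π₂.iso.isoM.symm (π₁.iso.isoM m) := rfl

/-- `e₂⁻¹ e₁` maps `e₁⁻¹H` into `e₂⁻¹H`. [cite: MochizukiAbsTopIII2015, Definition 3.1 (ii) p.67] -/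
theorem map_changeIso_le (H : OpenSubgroup P.Pi) :
    ((π₁.comapOpen H : OpenSubgroup π₁.D.tmPair.Pi) : Subgroup π₁.D.Pi).map
        (changeIso π₁ π₂).isoPi.toMonoidHom ≤
      ((π₂.comapOpen H : OpenSubgroup π₂.D.tmPair.Pi) : Subgroup π₂.D.Pi) := by
  rintro _ ⟨x, hx, rfl⟩
  change π₂.iso.isoPi (π₂.iso.isoPi.symm (π₁.iso.isoPi x)) ∈ (H : Subgroup P.Pi)
  rw [ContinuousMulEquiv.apply_symm_apply]
  exact hx

/-- `e₂⁻¹ e₁ : e₁⁻¹H → e₂⁻¹H` is bijective. [cite: MochizukiAbsTopIII2015, Definition 3.1 (ii) p.67] -/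
theorem changeIso_restrict_bijective (H : OpenSubgroup P.Pi) :
    Function.Bijective ((changeIso π₁ π₂).unitsMorphism.groupHomRestrict (map_changeIso_le π₁ π₂ H)) := by
  constructor
  · intro x y hxy
    apply Subtype.ext
    have h := congrArg (fun z : π₂.comapOpen H => ((z : π₂.D.Pi))) hxy
    exact (changeIso π₁ π₂).isoPi.injective h
  · intro y
    refine ⟨⟨(changeIso π₁ π₂).isoPi.symm y, ?_⟩, Subtype.ext ?_⟩
    · change π₁.iso.isoPi ((changeIso π₁ π₂).isoPi.symm y) ∈ (H : Subgroup P.Pi)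
      have hy : π₂.iso.isoPi (y : π₂.D.Pi) ∈ (H : Subgroup P.Pi) := y.2
      convert hy using 1
      change π₁.iso.isoPi (π₁.iso.isoPi.symm (π₂.iso.isoPi (y : π₂.D.Pi))) = _
      rw [ContinuousMulEquiv.apply_symm_apply]
    · exact (changeIso π₁ π₂).isoPi.apply_symm_apply y

/-- The units component `unitsLift (e₂⁻¹ e₁)` of the change of presentation is bijective.
[cite: MochizukiAbsTopIII2015, Definition 3.1 (iii) p.68] -/
theorem changeIso_unitsLift_bijective : Function.Bijective (changeIso π₁ π₂).unitsMorphism.map :=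
  ModelMLFGaloisData.unitsLift_bijective (changeIso π₁ π₂).isoM

end Canonical

section CanonicalEquiv

variable {P : GaloisMonoidPair.{0}} (π₁ π₂ : P.ModelPresentation) (H : OpenSubgroup P.Pi)

/-- **The canonical identification of the cohomology carriers of two presentations**:
`(π₁.kummerTheory).H¹(H) = H¹(e₁⁻¹H, Λ(k̄₁ˣ)) ≅ H¹(e₂⁻¹H, Λ(k̄₂ˣ)) = (π₂.kummerTheory).H¹(H)` — the comparison
isomorphism (`EquivariantMorphism.comparisonIso`: pull-back along `e₂⁻¹e₁ : e₁⁻¹H ⥲ e₂⁻¹H`, push-forward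
along `Λ(e₂⁻¹e₁)`, both invertible) in `ModuleCat ℤ`. [cite: MochizukiAbsTopIII2015, Proposition 3.2 (ii) p.71] -/
def canonicalIso :
    groupCohomology.H1 (cyclotomeRep (A := (π₁.C.K)ˣ)
        ((π₁.comapOpen H : OpenSubgroup π₁.D.tmPair.Pi) : Subgroup π₁.D.Pi)) ≅
      groupCohomology.H1 (cyclotomeRep (A := (π₂.C.K)ˣ)
        ((π₂.comapOpen H : OpenSubgroup π₂.D.tmPair.Pi) : Subgroup π₂.D.Pi)) :=
  (changeIso π₁ π₂).unitsMorphism.comparisonIso (map_changeIso_le π₁ π₂ H)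
    (changeIso_restrict_bijective π₁ π₂ H) (changeIso_unitsLift_bijective π₁ π₂)

/-- The same identification as an additive isomorphism of the carriers
`(π₁.kummerTheory).coh.H1 H ≃+ (π₂.kummerTheory).coh.H1 H`. [cite: MochizukiAbsTopIII2015, Proposition 3.2 (ii) p.71] -/
def canonicalEquiv : π₁.kummerTheory.coh.H1 H ≃+ π₂.kummerTheory.coh.H1 H :=
  (canonicalIso π₁ π₂ H).toLinearEquiv.toAddEquiv

/-- `canonicalEquiv` is the underlying map of `canonicalIso`. [cite: MochizukiAbsTopIII2015, Proposition 3.2 (ii) p.71] -/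
theorem canonicalEquiv_apply (x : π₁.kummerTheory.coh.H1 H) :
    canonicalEquiv π₁ π₂ H x = (canonicalIso π₁ π₂ H).hom x := rfl

/-- **CANONICITY of the transported Kummer theory ([AbsTopIII] Prop 3.2 (ii) on abstract pairs).**  For two
model presentations `π₁ = (k₁, e₁)`, `π₂ = (k₂, e₂)` of the same pair `P = (Π ↷ M)`, every open `H ⊆ Π` and every
`m ∈ M^H`, the canonical identification of carriers takes the Kummer class of `m` for `π₁` to the Kummer class
of `m` for `π₂`:  `canonicalEquiv (κ⁽¹⁾_H(m)) = κ⁽²⁾_H(m)`.  Hence the Kummer maps packaged existentially in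
`exists_monoidKummerTheory_recoversClosure` are independent of the chosen model, up to canonical isomorphism.
[cite: MochizukiAbsTopIII2015, Proposition 3.2 (ii) p.71] -/
theorem canonicalEquiv_kummer (m : {m : P.M // ∀ h : H, (h : P.Pi) • m = m}) :
    canonicalEquiv π₁ π₂ H (π₁.kummerTheory.kummer H m) = π₂.kummerTheory.kummer H m := by
  rw [canonicalEquiv_apply, kummerTheory_kummer, kummerTheory_kummer, ModelMLFGaloisData.kummerTheory_kummer,
    ModelMLFGaloisData.kummerTheory_kummer]
  refine (changeIso π₁ π₂).unitsMorphism.comparisonIso_kummerClass (map_changeIso_le π₁ π₂ H)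
    (changeIso_restrict_bijective π₁ π₂ H) (changeIso_unitsLift_bijective π₁ π₂) _ _ ?_
  change ModelMLFGaloisData.unitsLift (changeIso π₁ π₂).isoM.toMonoidHom
      (ModelMLFGaloisData.toUnit (π₁.iso.isoM.symm m.1)) = ModelMLFGaloisData.toUnit (π₂.iso.isoM.symm m.1)
  rw [ModelMLFGaloisData.unitsLift_toUnit]
  congr 1
  change π₂.iso.isoM.symm (π₁.iso.isoM (π₁.iso.isoM.symm m.1)) = _
  rw [MulEquiv.apply_symm_apply]

end CanonicalEquiv

end ModelPresentation

end GaloisMonoidPair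

end Literature.AnabelianGeometry.AbsoluteAnabelian

end
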